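import Mathlib.RingTheory.LocalRing.Length
import Mathlib.AlgebraicGeometry.Stalk
import Mathlib.AlgebraicGeometry.Morphisms.Preimmersion
import Literature.AlgebraicGeometry.Motives.CyclesEquivalences
import HarnessLib

/-!
# Hodge family: proof of Fulton's Lemma 1.7.1, `f^*[V] = [f⁻¹(V)]`

Discharge of the named fact `Literature.AlgebraicGeometry.Motives.flatPullback_cycle_eq_cycle_preimage` of
`Literature.AlgebraicGeometry.Motives.CyclesEquivalences` (Fulton, *Intersection Theory*,
Lemma 1.7.1: for `f : X ⟶ Y` flat and `V ↪ Y` a closed subscheme, `f^*[V] = [f⁻¹(V)]`), as the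
theorem `flatPullback_cycle_eq_cycle_preimage_holds`, for flat morphisms locally of finite type
between locally Noetherian schemes exactly as the fact is stated.

## The printed proof and its formalisation

Fulton's proof (loc. cit.): for an irreducible component `W` of `f⁻¹(V)` with generic point `w`
over `v ∈ V`, apply Lemma A.4.1 — for a flat local homomorphism `A → B` of Artinian local rings,
`ℓ_B(B) = ℓ_A(A) · ℓ_B(B/𝔪_A B)` — to `A = 𝒪_{V,v}`, `B = 𝒪_{f⁻¹V,w}`. Mathlib has Lemma A.4.1 in
the sharper form `IsLocalRing.length_baseChange` (`ℓ_B(B ⊗_A M) = ℓ_A(M) · ℓ_B(B/𝔪_A B)` in `ℕ∞`,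
no finiteness needed), which also covers the junk values of `Literature.AlgebraicGeometry.Motives.stalkLength` (`⊤ ↦ 0`): both
sides of the pointwise identity vanish unless all three local rings are Artinian.

The cycle-level statement compares, at `x ∈ X` with `y = f x`, the coefficient
`[V](y) · ℓ(𝒪_{X_y,x})` of `f^*[V]` (prelude `SubschemeCycles`: `flatPullback_apply`) with the
coefficient of `[f⁻¹(V)] = ι_*[V ×_Y X]`. The ingredients, all proved here:

* `map_apply_of_isClosedImmersion`, `map_apply_of_notMem_range`: Mathlib's proper push-forward
  `AlgebraicCycle.map i height height` along a closed immersion `i` is extension by zero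
  (closed immersions preserve `Order.height` for the specialisation order and have residue
  degree `1`);
* `ker_stalkMap_of_isPullback`: for a cartesian square `fst ≫ g = snd ≫ f` with `g` a
  preimmersion and `w ↦ x`, the surjection `𝒪_{X,x} ⟶ 𝒪_{P,w}` has kernel `J 𝒪_{X,x}` with
  `J = ker (𝒪_{Y,y} ⟶ 𝒪_{T,fst w})`, i.e. `𝒪_{P,w} = 𝒪_{X,x} ⊗_{𝒪_{Y,y}} 𝒪_{T,fst w}`; the
  non-formal inclusion tests against `Spec (𝒪_{X,x}/J𝒪_{X,x}) ⟶ P` (universal property and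
  Mathlib's `SpecToEquivOfLocalRing` / `Scheme.stalkClosedPointTo`);
* `length_stalk_of_isPullback`: hence `ℓ(𝒪_{P,w}) = ℓ(𝒪_{T,fst w}) · ℓ(𝒪_{X,x}/𝔪_y 𝒪_{X,x})`
  for `f` flat (`IsLocalRing.length_baseChange`), applied twice: to `V ↪ Y` (giving
  `𝒪_{f⁻¹V,w}`) and to `Spec κ(y) ⟶ Y` (giving the fibre, `length_stalk_fiber`:
  `ℓ(𝒪_{X_y,x}) = ℓ(𝒪_{X,x}/𝔪_y 𝒪_{X,x})`), whence `stalkLength_pullback_eq_mul`: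
  `ℓ(𝒪_{f⁻¹V,w}) = ℓ(𝒪_{V,v}) · ℓ(𝒪_{X_y,x})`.

## References

* W. Fulton, *Intersection Theory* (2nd ed. 1998; 1st ed. 1984 with the same numbering:
  Lemma 1.7.1 on p. 18, Lemma A.4.1 on p. 413), §1.7 and Appendix A.4.
-/
universe u

open CategoryTheory AlgebraicGeometry Limits Order TopologicalSpace IsLocalRing
open scoped TensorProduct

noncomputable section

namespace Literature.AlgebraicGeometry.Motives

section Hodge

section ClosedImmersionPushforward

variable {Z X : Scheme.{u}} (i : Z ⟶ X) [IsClosedImmersion i]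

/-- A closed immersion preserves `Order.height` for the specialisation order (the dimension of
the closure of a point): it is an order embedding whose range is stable under specialisation.
[folklore] -/
theorem height_apply_of_isClosedImmersion (z : Z) : height (i z) = height z := by
  have hind := i.isClosedEmbedding.isInducing
  symm
  apply Order.height_eq_of_strictMono
  · intro a b hab
    rw [lt_iff_le_not_ge, Scheme.le_iff_specializes, Scheme.le_iff_specializes] at hab ⊢
    exact ⟨hind.specializes_iff.mpr hab.1, fun h ↦ hab.2 (hind.specializes_iff.mp h)⟩
  · intro a b hb
    have hb' : b ≤ i a := hb.le
    rw [Scheme.le_iff_specializes] at hb'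
    obtain ⟨a', rfl⟩ : b ∈ Set.range i :=
      i.isClosedEmbedding.isClosed_range.stableUnderSpecialization hb' ⟨a, rfl⟩
    refine ⟨a', ?_, rfl⟩
    rw [lt_iff_le_not_ge, Scheme.le_iff_specializes, Scheme.le_iff_specializes] at hb ⊢
    exact ⟨hind.specializes_iff.mp hb.1, fun h ↦ hb.2 (hind.specializes_iff.mpr h)⟩

omit [IsClosedImmersion i] in
/-- A morphism that is surjective on the stalk at `z` induces an isomorphism of residue fields
at `z`, so its residue degree `[κ(z) : κ(i z)]` is `1`. [folklore] -/
theorem residueDegree_eq_one_of_stalkMap_surjective (z : Z)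
    (hi : Function.Surjective (i.stalkMap z)) : i.residueDegree z = 1 := by
  have hs : Function.Surjective (i.residueFieldMap z) := by
    intro r
    obtain ⟨s, rfl⟩ := Z.residue_surjective z r
    obtain ⟨t, rfl⟩ := hi s
    refine ⟨X.residue (i z) t, ?_⟩
    change (X.residue (i z) ≫ i.residueFieldMap z) t = (i.stalkMap z ≫ Z.residue z) t
    rw [Scheme.residue_residueFieldMap]
  unfold Scheme.Hom.residueDegree
  letI := (i.residueFieldMap z).hom.toAlgebra
  have hb : Function.Bijective (algebraMap (X.residueField (i z)) (Z.residueField z)) :=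
    ⟨RingHom.injective _, hs⟩
  rw [← (AlgEquiv.ofBijective (Algebra.ofId _ _) hb).toLinearEquiv.finrank_eq, Module.finrank_self]

/-- Push-forward of a cycle along a closed immersion is extension by zero: at a point of the
image, the coefficient is unchanged (heights agree and the residue degree is `1`). [folklore] -/
theorem map_apply_of_isClosedImmersion (c : AlgebraicCycle Z ℤ) (z : Z) :
    AlgebraicCycle.map i height height c (i z) = c z := by
  have hinj : Function.Injective i := i.isClosedEmbedding.injective
  simp only [AlgebraicCycle.map, Function.locallyFinsupp.map_apply]
  have : (i : Z → X) ⁻¹' {i z} = {z} := by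
    rw [← Set.image_singleton, hinj.preimage_image]
  rw [show (⇑(ConcreteCategory.hom i.base)) ⁻¹' {i z} = {z} from this, finsum_mem_singleton]
  simp [AlgebraicCycle.mapCoeff, height_apply_of_isClosedImmersion,
    residueDegree_eq_one_of_stalkMap_surjective i z (i.stalkMap_surjective z)]

/-- Push-forward of a cycle along a closed immersion vanishes off the image. [folklore] -/
theorem map_apply_of_notMem_range (c : AlgebraicCycle Z ℤ) (x : X) (hx : x ∉ Set.range i) :
    AlgebraicCycle.map i height height c x = 0 := by
  simp only [AlgebraicCycle.map, Function.locallyFinsupp.map_apply]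
  have : (i : Z → X) ⁻¹' {x} = ∅ := by
    ext z
    simp only [Set.mem_preimage, Set.mem_singleton_iff, Set.mem_empty_iff_false, iff_false]
    rintro rfl
    exact hx ⟨z, rfl⟩
  rw [show (⇑(ConcreteCategory.hom i.base)) ⁻¹' {x} = ∅ from this, finsum_mem_empty]

end ClosedImmersionPushforward

/-- Isomorphic commutative rings have the same length as modules over themselves. [folklore] -/
theorem CyclesEquivalencesFlatPullbackProofs.length_self_eq_of_ringEquiv {R S : Type*} [CommRing R] [CommRing S] (e : R ≃+* S) :
    Module.length R R = Module.length S S := by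
  apply WithBot.coe_injective
  rw [Module.coe_length, Module.coe_length]
  exact (Order.krullDim_eq_of_orderIso e.idealComapOrderIso).symm

section StalkBaseChange

variable {P T X Y : Scheme.{u}} {fst : P ⟶ T} {snd : P ⟶ X} {g : T ⟶ Y} {f : X ⟶ Y}

/-- Base change of a preimmersion is surjective on stalks (Mathlib: preimmersions are stable
under base change). [folklore] -/
theorem stalkMap_surjective_of_isPullback (H : IsPullback fst snd g f) [IsPreimmersion g]
    (w : P) : Function.Surjective (snd.stalkMap w) := by
  have : IsPreimmersion snd := MorphismProperty.of_isPullback (P := @IsPreimmersion) H ‹_›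
  exact snd.stalkMap_surjective w

/-- The easy half of the stalk computation for a base change: the stalk map of `snd` kills the
extension of the kernel of the stalk map of `g`. [folklore] -/
theorem map_ker_le_ker_stalkMap_of_isPullback (H : IsPullback fst snd g f) (w : P) (x : X)
    (hx : snd w = x) (hy : f x = g (fst w)) :
    Ideal.map (f.stalkMap x).hom
        (RingHom.ker ((Y.presheaf.stalkCongr (.of_eq hy)).hom ≫ g.stalkMap (fst w)).hom) ≤
      RingHom.ker ((X.presheaf.stalkCongr (.of_eq hx)).inv ≫ snd.stalkMap w).hom := by
  subst hx
  rw [Ideal.map_le_iff_le_comap]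
  intro a ha
  have h1 := Scheme.Hom.stalkMap_congr_hom (snd ≫ f) (fst ≫ g) H.w.symm w
  rw [Scheme.Hom.stalkMap_comp, Scheme.Hom.stalkMap_comp] at h1
  have := congr($(h1) a)
  simp only [RingHom.mem_ker, CommRingCat.hom_comp, RingHom.coe_comp, Function.comp_apply,
    Ideal.mem_comap, TopCat.Presheaf.stalkCongr_hom, TopCat.Presheaf.stalkCongr_inv,
    TopCat.Presheaf.stalkSpecializes_refl, CommRingCat.hom_id, RingHom.id_apply] at ha this ⊢
  rw [this]
  exact (congrArg (fst.stalkMap w).hom ha).trans (map_zero _)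

/-- **Stalks of the base change of a preimmersion.** For a cartesian square `fst ≫ g = snd ≫ f`
with `g : T ⟶ Y` a preimmersion (e.g. a closed immersion, or `Spec κ(y) ⟶ Y`) and `w ∈ P`
over `x ∈ X`, the (surjective) stalk map `𝒪_{X,x} ⟶ 𝒪_{P,w}` has kernel `J · 𝒪_{X,x}`, where
`J = ker (𝒪_{Y,y} ⟶ 𝒪_{T,t})`; i.e. `𝒪_{P,w} = 𝒪_{X,x} ⊗_{𝒪_{Y,y}} 𝒪_{T,t}`. The inclusion `⊇`
is formal; `⊆` tests against the morphism `Spec (𝒪_{X,x} / J 𝒪_{X,x}) ⟶ P` through the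
universal property and Mathlib's `SpecToEquivOfLocalRing` (morphisms `Spec R ⟶ P` from a
local scheme correspond to local homomorphisms out of stalks of `P`). [folklore] -/
theorem ker_stalkMap_of_isPullback (H : IsPullback fst snd g f) [IsPreimmersion g] (w : P)
    (x : X) (hx : snd w = x) (hy : f x = g (fst w)) :
    RingHom.ker ((X.presheaf.stalkCongr (.of_eq hx)).inv ≫ snd.stalkMap w).hom =
      Ideal.map (f.stalkMap x).hom
        (RingHom.ker ((Y.presheaf.stalkCongr (.of_eq hy)).hom ≫ g.stalkMap (fst w)).hom) := by
  refine le_antisymm ?_ (map_ker_le_ker_stalkMap_of_isPullback H w x hx hy)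
  have hsnd : IsPreimmersion snd := MorphismProperty.of_isPullback (P := @IsPreimmersion) H ‹_›
  set B := X.presheaf.stalk x with hB
  set A := Y.presheaf.stalk (f x) with hA
  set σT := (Y.presheaf.stalkCongr (.of_eq hy)).hom ≫ g.stalkMap (fst w) with hσT
  set J := RingHom.ker σT.hom with hJdef
  set JB := Ideal.map (f.stalkMap x).hom J with hJBdef
  have hσTs : Function.Surjective σT.hom :=
    (g.stalkMap_surjective (fst w)).comp (ConcreteCategory.bijective_of_isIso _).2
  have hJ : J ≤ maximalIdeal A := IsLocalRing.le_maximalIdeal (RingHom.ker_ne_top _)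
  have hJB : JB ≤ maximalIdeal B := (Ideal.map_mono hJ).trans (map_maximalIdeal_le _)
  have hJBtop : JB ≠ ⊤ := fun h ↦
    (maximalIdeal.isMaximal B).ne_top (top_le_iff.mp (h ▸ hJB))
  haveI : Nontrivial (B ⧸ JB) := Ideal.Quotient.nontrivial_iff.mpr hJBtop
  haveI : IsLocalRing (B ⧸ JB) :=
    IsLocalRing.of_surjective' (Ideal.Quotient.mk JB) Ideal.Quotient.mk_surjective
  let R : CommRingCat.{u} := CommRingCat.of (B ⧸ JB)
  let q : B ⟶ R := CommRingCat.ofHom (Ideal.Quotient.mk JB)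
  haveI hq : IsLocalHom q.hom := IsLocalHom.of_surjective _ Ideal.Quotient.mk_surjective
  -- the induced map `𝒪_{T, fst w} ⟶ R`
  let c0 : A ⧸ J →+* B ⧸ JB := Ideal.quotientMap JB (f.stalkMap x).hom Ideal.le_comap_map
  let c : T.presheaf.stalk (fst w) ⟶ R :=
    CommRingCat.ofHom (c0.comp (RingHom.quotientKerEquivOfSurjective hσTs).symm.toRingHom)
  have hc : σT ≫ c = f.stalkMap x ≫ q := by
    ext a
    change c0 ((RingHom.quotientKerEquivOfSurjective hσTs).symm (σT.hom a)) =
      Ideal.Quotient.mk JB (f.stalkMap x a)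
    rw [RingHom.quotientKerEquivOfSurjective_symm_apply]
    rfl
  -- the two test maps
  let φX : Spec R ⟶ X := Spec.map q ≫ X.fromSpecStalk x
  let φT : Spec R ⟶ T := Spec.map c ≫ T.fromSpecStalk (fst w)
  have hcomm : φT ≫ g = φX ≫ f := by
    simp only [φT, φX, Category.assoc]
    rw [← Scheme.SpecMap_stalkMap_fromSpecStalk g, ← Scheme.SpecMap_stalkMap_fromSpecStalk f,
      ← Scheme.SpecMap_stalkSpecializes_fromSpecStalk (Inseparable.of_eq hy).ge]
    simp only [← Spec.map_comp_assoc]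
    congr 1
    rw [← hc]
    simp [σT]
  let φ : Spec R ⟶ P := H.lift φT φX hcomm
  have hφX : φ ≫ snd = φX := H.lift_snd _ _ _
  have h₁ : φX (closedPoint (B ⧸ JB)) = x := by
    simp only [φX, Scheme.Hom.comp_apply]
    rw [Spec_closedPoint, Scheme.fromSpecStalk_closedPoint]
  have hpt : φ (closedPoint (B ⧸ JB)) = w := by
    apply snd.isEmbedding.injective
    rw [← Scheme.Hom.comp_apply, hφX, h₁, hx]
  have E1 : Scheme.stalkClosedPointTo φX = (X.presheaf.stalkCongr (.of_eq h₁)).hom ≫ q := by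
    refine TopCat.Presheaf.stalk_hom_ext _ fun U hxU ↦ ?_
    simp only [φX, Scheme.germ_stalkClosedPointTo_Spec_fromSpecStalk,
      TopCat.Presheaf.stalkCongr_hom, TopCat.Presheaf.germ_stalkSpecializes_assoc]
  -- make `φ`, `φX` opaque and substitute `φX := φ ≫ snd`
  clear_value φ φX φT
  subst hφX
  have h₁' : snd (φ (closedPoint R)) = x := h₁
  have KEY : snd.stalkMap (φ (closedPoint R)) ≫ Scheme.stalkClosedPointTo φ =
      (X.presheaf.stalkCongr (.of_eq h₁')).hom ≫ q := by
    rw [← Scheme.stalkClosedPointTo_comp φ snd]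
    exact E1
  have E4 := Scheme.Hom.stalkMap_congr_point snd _ w hpt
  intro b hb
  rw [← Ideal.Quotient.eq_zero_iff_mem]
  change q.hom b = 0
  set b₁ := (X.presheaf.stalkCongr (.of_eq h₁')).inv b with hb₁
  have k1 := congr($(KEY) b₁)
  have k4 := congr($(E4) b₁)
  simp only [CommRingCat.hom_comp, RingHom.coe_comp, Function.comp_apply, b₁,
    Iso.inv_hom_id_apply] at k1 k4
  rw [← k1]
  simp only [RingHom.mem_ker, CommRingCat.hom_comp, RingHom.coe_comp, Function.comp_apply,
    TopCat.Presheaf.stalkCongr_hom, TopCat.Presheaf.stalkCongr_inv,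
    TopCat.Presheaf.stalkSpecializes_comp_apply] at hb k4
  rw [hb] at k4
  have hinj := (ConcreteCategory.bijective_of_isIso
    (P.presheaf.stalkCongr (.of_eq hpt : Inseparable (φ (closedPoint R)) w)).hom).1
  have h0 : (snd.stalkMap (φ (closedPoint R))).hom b₁ = 0 := by
    apply hinj
    simpa [b₁] using k4
  rw [h0, map_zero]

/-- **Lengths of stalks of the base change of a preimmersion** (from Fulton, *Intersection
Theory*, Lemma A.4.1 = Mathlib `IsLocalRing.length_baseChange`). For a cartesian square
`fst ≫ g = snd ≫ f` with `g` a preimmersion and `f` flat, and `w ∈ P` over `x ∈ X`, `y = f x`: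
`ℓ(𝒪_{P,w}) = ℓ(𝒪_{T,fst w}) · ℓ_{𝒪_{X,x}}(𝒪_{X,x} / 𝔪_y 𝒪_{X,x})` in `ℕ∞`, lengths of local
rings being taken over themselves. Indeed `𝒪_{P,w} = B ⊗_A A/J` for `A = 𝒪_{Y,y} → B = 𝒪_{X,x}`
flat local and `A/J = 𝒪_{T, fst w}` (`ker_stalkMap_of_isPullback`). [folklore] -/
theorem length_stalk_of_isPullback (H : IsPullback fst snd g f) [IsPreimmersion g] [Flat f]
    (w : P) (x : X) (hx : snd w = x) (hy : f x = g (fst w)) :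
    Module.length (P.presheaf.stalk w) (P.presheaf.stalk w) =
      Module.length (T.presheaf.stalk (fst w)) (T.presheaf.stalk (fst w)) *
        Module.length (X.presheaf.stalk x) ((X.presheaf.stalk x) ⧸
          (maximalIdeal (Y.presheaf.stalk (f x))).map (f.stalkMap x).hom) := by
  set B := X.presheaf.stalk x with hB
  set A := Y.presheaf.stalk (f x) with hA
  set OP := P.presheaf.stalk w with hOP
  set OT := T.presheaf.stalk (fst w) with hOT
  letI alg : Algebra A B := (f.stalkMap x).hom.toAlgebra
  haveI : IsLocalHom (algebraMap A B) := inferInstanceAs (IsLocalHom (f.stalkMap x).hom)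
  haveI : Module.Flat A B := Flat.stalkMap f x
  set σX := (X.presheaf.stalkCongr (.of_eq hx)).inv ≫ snd.stalkMap w with hσX
  set σT := (Y.presheaf.stalkCongr (.of_eq hy)).hom ≫ g.stalkMap (fst w) with hσT
  have hσXs : Function.Surjective σX.hom :=
    (stalkMap_surjective_of_isPullback H w).comp (ConcreteCategory.bijective_of_isIso _).2
  have hσTs : Function.Surjective σT.hom :=
    (g.stalkMap_surjective (fst w)).comp (ConcreteCategory.bijective_of_isIso _).2
  set J := RingHom.ker σT.hom with hJ
  have hker : RingHom.ker σX.hom = J.map (algebraMap A B) :=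
    ker_stalkMap_of_isPullback H w x hx hy
  -- `𝒪_{P,w}` as a `B`-module
  letI algP : Algebra B OP := σX.hom.toAlgebra
  have s1 : Module.length OP OP = Module.length B OP :=
    (Module.length_eq_of_surjective (S := B) (R := OP) (M := OP) hσXs).symm
  have e2 : (B ⧸ RingHom.ker σX.hom) ≃ₗ[B] OP :=
    (Ideal.quotientKerAlgEquivOfSurjective (f := Algebra.ofId B OP) hσXs).toLinearEquiv
  have s2 : Module.length B OP = Module.length B (B ⊗[A] (A ⧸ J)) := by
    rw [← e2.length_eq, hker]
    exact (Algebra.TensorProduct.quotIdealMapEquivTensorQuot B J).toLinearEquiv.length_eq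
  -- `𝒪_{T,fst w}` as an `A`-module
  letI algT : Algebra A OT := σT.hom.toAlgebra
  have e3 : (A ⧸ J) ≃ₗ[A] OT :=
    (Ideal.quotientKerAlgEquivOfSurjective (f := Algebra.ofId A OT) hσTs).toLinearEquiv
  have s3 : Module.length A (A ⧸ J) = Module.length OT OT := by
    rw [e3.length_eq]
    exact Module.length_eq_of_surjective (S := A) (R := OT) (M := OT) hσTs
  rw [s1, s2, IsLocalRing.length_baseChange A B (A ⧸ J), s3]
  rfl

end StalkBaseChange

section Fiber

variable {X Y : Scheme.{u}}

/-- The local ring of `Spec κ(y)` at its point has length `1` (it is the field `κ(y)`).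
[folklore] -/
theorem length_stalk_Spec_residueField (y : Y) (t : Spec (Y.residueField y)) :
    Module.length ((Spec (Y.residueField y)).presheaf.stalk t)
      ((Spec (Y.residueField y)).presheaf.stalk t) = 1 := by
  haveI : Subsingleton ↥(Spec (Y.residueField y)) :=
    inferInstanceAs (Subsingleton (PrimeSpectrum (Y.residueField y)))
  obtain rfl : t = closedPoint (Y.residueField y) := Subsingleton.elim _ _
  rw [CyclesEquivalencesFlatPullbackProofs.length_self_eq_of_ringEquiv
      (stalkClosedPointIso (Y.residueField y)).commRingCatIsoToRingEquiv,
    Module.length_eq_finrank, Module.finrank_self, Nat.cast_one]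

/-- **Stalks of fibres.** For `f : X ⟶ Y` flat and `x ∈ X` with `y = f x`, the local ring of the
scheme-theoretic fibre `X_y` at `x` has the same length as `𝒪_{X,x} / 𝔪_y 𝒪_{X,x}` (they are
isomorphic: `X_y = X ×_Y Spec κ(y)` and `Spec κ(y) ⟶ Y` is a preimmersion with stalk kernel
`𝔪_y`; `length_stalk_of_isPullback`). [folklore] -/
theorem length_stalk_fiber (f : X ⟶ Y) [Flat f] (x : X) :
    Module.length ((f.fiber (f x)).presheaf.stalk (f.asFiber x))
        ((f.fiber (f x)).presheaf.stalk (f.asFiber x)) =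
      Module.length (X.presheaf.stalk x) ((X.presheaf.stalk x) ⧸
        (maximalIdeal (Y.presheaf.stalk (f x))).map (f.stalkMap x).hom) := by
  have H := (IsPullback.of_hasPullback f (Y.fromSpecResidueField (f x))).flip
  have hy : f x = Y.fromSpecResidueField (f x) (f.fiberToSpecResidueField (f x) (f.asFiber x)) :=
    (Scheme.fromSpecResidueField_apply _ _).symm
  have := length_stalk_of_isPullback H (f.asFiber x) x (f.fiberι_asFiber x) hy
  rw [length_stalk_Spec_residueField, one_mul] at this
  exact this

end Fiber

/-! ### Assembly: Fulton's Lemma 1.7.1 -/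

section Main

variable {X Y : Scheme.{u}}

/-- **Multiplicities in `f⁻¹(V)`** (Fulton, *Intersection Theory*, proof of Lemma 1.7.1). For
`f : X ⟶ Y` flat, `V ↪ Y` a closed subscheme and `w ∈ f⁻¹(V) = V ×_Y X` over `v ∈ V` and
`x ∈ X`: `ℓ(𝒪_{f⁻¹V, w}) = ℓ(𝒪_{V,v}) · ℓ(𝒪_{X_{f x}, x})`, as natural numbers with the junk value
`0` for infinite lengths on both sides (`⊤ * n = ⊤` for `n ≠ 0` in `ℕ∞`, and local rings have
nonzero length). [cite: Fulton1998, Lemma 1.7.1] -/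
theorem stalkLength_pullback_eq_mul (f : X ⟶ Y) [Flat f] (V : ClosedSubscheme Y)
    (w : ↥(pullback V.ι f)) :
    stalkLength (pullback V.ι f) w =
      stalkLength V.carrier (pullback.fst V.ι f w) *
        stalkLength (f.fiber (f (pullback.snd V.ι f w))) (f.asFiber (pullback.snd V.ι f w)) := by
  unfold stalkLength
  rw [← ENat.toNat_mul]
  congr 1
  have hy : f (pullback.snd V.ι f w) = V.ι (pullback.fst V.ι f w) := by
    rw [← Scheme.Hom.comp_apply, ← pullback.condition, Scheme.Hom.comp_apply]
  rw [length_stalk_of_isPullback (IsPullback.of_hasPullback V.ι f) w _ rfl hy, length_stalk_fiber]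

/-- **Fulton, *Intersection Theory*, Lemma 1.7.1** (`f^*[V] = [f⁻¹(V)]` for `f` flat and `V` a
closed subscheme), discharging the named fact `flatPullback_cycle_eq_cycle_preimage`. Pointwise
at `x ∈ X`: off `f⁻¹(V)` both sides vanish; at `x = ι(w)` both sides equal
`ℓ(𝒪_{V,v}) · ℓ(𝒪_{X_{f x},x}) = ℓ(𝒪_{f⁻¹V,w})` (`stalkLength_pullback_eq_mul`, i.e. Fulton's
Lemma A.4.1 = Mathlib `IsLocalRing.length_baseChange`, applied to the flat local homomorphism
`𝒪_{Y,f x} → 𝒪_{X,x}`), push-forward along the closed immersions `V ↪ Y`, `f⁻¹(V) ↪ X` being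
extension by zero (`map_apply_of_isClosedImmersion`). [cite: Fulton1998, Lemma 1.7.1] -/
theorem flatPullback_cycle_eq_cycle_preimage_holds : flatPullback_cycle_eq_cycle_preimage.{u} := by
  intro X Y f _ _ _ _ hf hZ V
  haveI : IsClosedImmersion (pullback.snd V.ι f) := MorphismProperty.pullback_snd _ _ inferInstance
  ext x
  rw [flatPullback_apply]
  change (AlgebraicCycle.map V.ι height height (fundamentalCycle V.carrier hZ)) (f x) * _ =
    (AlgebraicCycle.map (pullback.snd V.ι f) height height (fundamentalCycle (pullback V.ι f) hZ)) x
  by_cases hx : x ∈ Set.range (pullback.snd V.ι f)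
  · obtain ⟨w, rfl⟩ := hx
    have hv : f (pullback.snd V.ι f w) = V.ι (pullback.fst V.ι f w) := by
      rw [← Scheme.Hom.comp_apply, ← pullback.condition, Scheme.Hom.comp_apply]
    have h1 : AlgebraicCycle.map V.ι height height (fundamentalCycle V.carrier hZ)
        (f (pullback.snd V.ι f w)) = stalkLength V.carrier (pullback.fst V.ι f w) := by
      rw [hv, map_apply_of_isClosedImmersion]
      rfl
    rw [h1, map_apply_of_isClosedImmersion, fundamentalCycle_apply, fundamentalCycleFun_apply,
      fundamentalCycleFun_apply, stalkLength_pullback_eq_mul f V w]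
    push_cast
    ring
  · rw [map_apply_of_notMem_range _ _ _ hx]
    have hx' : f x ∉ Set.range V.ι := by
      rwa [Scheme.Pullback.range_snd] at hx
    rw [map_apply_of_notMem_range _ _ _ hx', zero_mul]

end Main

end Hodge

end Literature.AlgebraicGeometry.Motives

end
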